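import Literature.Algebra.Lie.GradedJacobsonMorozov
import Literature.Algebra.Lie.JacobsonMorozovLinear
import Literature.Algebra.Lie.LefschetzModule
import Mathlib.LinearAlgebra.Matrix.ToLin
import HarnessLib

/-!
# The graded Jacobson–Morozov theorem for a homogeneous nilpotent endomorphism (Looijenga–Lunts 1997, (5.2)–(5.3) for `𝔤 = 𝔤𝔩(M)`)

Topic `Literature/Algebra/Lie` (namespace `Literature.Algebra.Lie`).  Lane `lit-hodgefound` (Track 2 foundations
library), skeleton seat `lit-hodgefound-skel-1` (generation 46), row **A1-146** of
`run/shared/lean/pub/lit-hodgefound/SKELETON.md`; the corollary of row A1-145 (`GradedJacobsonMorozov.lean`, Looijenga–Lunts'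
Lemma (5.2) for an abstract graded Lie algebra) for THE REDUCTIVE LIE ALGEBRA `𝔤 = 𝔤𝔩(M)` of a finite-dimensional vector
space graded by a commuting family of diagonalisable operators — the form in which (5.3) uses the lemma ("we find an
`𝔰𝔩₂`-triple `(e_a, h_hor, f_a)` in `𝔤(𝔞, M)` with `f_a` of total degree `-2` and `h_hor` of total degree `0`") and in
which Hodge theory uses it (an `𝔰𝔩₂`-triple through a nilpotent `N` of bidegree `(-1, -1)` whose semisimple element
preserves the bigrading).  As in the tree's `JacobsonMorozovLinear.lean` the statements are RING IDENTITIES in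
`Module.End K M` (`HN - NH = 2N`, …), so that no Lie-algebra instance on `End(M)` is needed to use them; THEOREMS ONLY
(no definition, no named fact, no `sorry`, no instance or instance attribute — Mathlib's commutator Lie structure
`LieRing.ofAssociativeRing` is invoked by `letI` INSIDE the proofs only; D-0026 net debt `0`).

## Source, VERBATIM

E. Looijenga, V. A. Lunts, *A Lie algebra attached to a projective variety*, Invent. Math. **129** (1997) 361–412
(held TeX text `paper:arxiv-alg-geom_9604014`), §5:

> (5.2) p0020 L108–L112: "**Lemma.** Let `𝔤` be a reductive Lie algebra, `𝔰 ⊂ 𝔤` a commutative subalgebra consisting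
> of semisimple elements and `χ ∈ 𝔰^*` a character of `𝔰` in `𝔤`. Then for every nilpotent `e ∈ 𝔤^χ` there exists a
> `f ∈ 𝔤^{-χ}` such that `(e, [e, f], f)` is an `𝔰𝔩(2)`-triple."
> (5.3) p0021 L11–L19: "Suppose now that some `a ∈ 𝔞` preserves the vertical grading … and has the Lefschetz property in
> `Gr_hor M` … If we apply 5.2 to `e := e_a` and `𝔰 := ℂh`, we find an `𝔰𝔩₂`-triple `(e_a, h_hor, f_a)` in `𝔤(𝔞, M)`
> with `f_a` of total degree `-2` and `h_hor` of total degree `0`."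

## Rendering (dictionary)

* `𝔤 = 𝔤𝔩(M) = Module.End K M` (reductive; every nilpotent ENDOMORPHISM is a nilpotent element of it and lies in an
  `𝔰𝔩₂`-triple of `𝔤𝔩(M)` — the tree's `exists_sl2Triple_of_isNilpotent`, Bourbaki VIII §11 Prop. 2 for `𝔰𝔩(M)`).
* `𝔰 = span {s_i}` for a commuting family `s : ι → End K M` of DIAGONALISABLE operators ("semisimple elements":
  `⨆ μ, eigenspace (s i) μ = ⊤`), e.g. ONE grading operator `h` of a graded `M = ⊕ M_k` (`𝔰 = Kh`, (5.3)), or the two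
  degree operators of a bigrading; `χ ∈ 𝔰^*` = its values `c : ι → K`; "`N ∈ 𝔤^χ`" = `s i * N - N * s i = c i • N`
  (`N` is multi-homogeneous of multi-degree `c`).
* "`(e, [e, f], f)` is an `𝔰𝔩(2)`-triple" = the ring identities `H * N - N * H = 2 • N`, `H * F - F * H = -(2 • F)`,
  `N * F - F * N = H`, `H ≠ 0` in `End(M)` (= Mathlib's `IsSl2Triple H N F` for the commutator bracket).

## Contents (all proved; `K` a field of characteristic `0`, `M` finite-dimensional)

* §1 **`iSup_eigenspace_mulLeft_sub_mulRight_eq_top`** — "`s` semisimple ⟹ `ad s` semisimple on `𝔤𝔩(M)`", split form: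
  if `s` is diagonalisable on `M` then `ad s = L_s - R_s` (`LinearMap.mulLeft K s - LinearMap.mulRight K s`) is
  diagonalisable on `End(M)` (the matrix units of an eigenbasis are eigenvectors, Mathlib
  `Module.Basis.lie_end_of_apply_eq_smul`).
* §2 **`exists_sl2Triple_of_isNilpotent_of_forall_commutator_eq`** — THE MULTI-HOMOGENEOUS JACOBSON–MOROZOV THEOREM IN
  `𝔤𝔩(M)`: for commuting diagonalisable `s_i` and a nilpotent `N ≠ 0` with `s_i N - N s_i = c_i N` there are `H, F`
  with `(N, H, F)` an `𝔰𝔩₂`-triple, `s_i H = H s_i` and `s_i F - F s_i = -c_i F`; the one-operator case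
  **`exists_sl2Triple_of_isNilpotent_of_commutator_eq`**; and the `ℤ`-graded case in the vocabulary of A1-88
  (**`IsZGrading.exists_sl2Triple_of_isNilpotent`**: `M = ⊕_k M_k`, `N` nilpotent of degree `d ⟹ H` of degree `0`, `F`
  of degree `-d`) — (5.3)'s "`f_a` of total degree `-2` and `h_hor` of total degree `0`".
* §3 **`commutator_eq_neg_smul_of_sl2Triple`** — automatic homogeneity of the third member: if `(N, H, F)` is ANY
  `𝔰𝔩₂`-triple of `𝔤𝔩(M)` with `s H = H s`, `s N - N s = c N` (`s` diagonalisable), then `s F - F s = -c F`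
  (Bourbaki VIII §11 Lemma 1 via A1-145 `mem_adDegree_neg_of_isSl2Triple`).

## Proof

Equip `End(M)` (inside the proofs) with the commutator Lie structure; `L = 𝔤𝔩(M)` is graded by the simultaneous
eigenspaces `⨅ i, adDegree K (s i) (χ i)` of the `ad s_i` (A1-145 `isInternal_iInf_adDegree`, applicable by §1); the
tree's Jacobson–Morozov theorem for endomorphisms gives some triple `(N, H', F')`, and A1-145's graded refinement
`exists_mem_isSl2Triple_of_isSl2Triple` — the printed proof of (5.2): `h := [N, F'_{-χ}] = H'_0`, Bourbaki VIII §11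
Lemma 6, `F := f_{-χ}` — replaces it by a homogeneous one.

## SCOPE

(a) "semisimple" is taken split (diagonalisable over `K`), as in A1-145.  (b) The version INSIDE `𝔤(𝔞, M)` for a
Lefschetz module — the triple `(e_a, h_hor, f_a)` of (5.3) lies in `𝔤(𝔞, M)`, not only in `𝔤𝔩(M)` — is A1-145 §5
(`IsLefschetzTriple.exists_mem_adDegree_isSl2Triple`) applied to the Lefschetz triple `(𝔤(𝔞, M), h, 𝔞)` of A1-101; it is
not restated here.  (c) Nothing here concerns complex tori or the Hodge conjecture.

## References

* [LooijengaLunts1997] E. Looijenga, V. A. Lunts, *A Lie algebra attached to a projective variety*, Invent. Math. 129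
  (1997) 361–412; arXiv:alg-geom/9604014. §5 (5.2) p. 20 L108–L121, (5.3) p. 21 L11–L19 of the held TeX text.
* [Bourbaki2008LieGroups79] N. Bourbaki, *Lie Groups and Lie Algebras, Chapters 7–9*, Ch. VIII §11 no. 1 Lemma 1,
  no. 2 Lemma 6, Prop. 2 — via the tree's `JacobsonMorozov.lean` / `JacobsonMorozovLinear.lean`.
-/

namespace Literature.Algebra.Lie

open Module Function Set LieAlgebra

universe u v

/-! ### §1 A diagonalisable `s` has a diagonalisable `ad s = L_s - R_s` on `End(M)` -/

section AdDiagonalisable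

variable {K : Type u} [Field K] {V : Type v} [AddCommGroup V] [Module K V] [FiniteDimensional K V]

/-- **"`𝔰` … consisting of semisimple elements" transported to `𝔤𝔩(M)`**: if `s ∈ End(M)` is diagonalisable
(`⨆ μ, E_μ(s) = M`) then so is `ad s = L_s - R_s` on `End(M)`: `⨆ μ, E_μ(L_s - R_s) = End(M)` — the matrix units
`E_{ij}` of an eigenbasis (`s v_i = a_i v_i`) satisfy `[s, E_{ij}] = (a_i - a_j) E_{ij}` (Mathlib
`Module.Basis.lie_end_of_apply_eq_smul`) and span `End(M)` (Mathlib `Module.Basis.end`).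
[cite: LooijengaLunts1997, §5 (5.2) p. 20 L109–L110 ("consisting of semisimple elements")] -/
theorem iSup_eigenspace_mulLeft_sub_mulRight_eq_top {s : Module.End K V} (hdiag : ⨆ μ : K, s.eigenspace μ = ⊤) :
    ⨆ μ : K, Module.End.eigenspace (LinearMap.mulLeft K s - LinearMap.mulRight K s) μ = ⊤ := by
  classical
  have hint : DirectSum.IsInternal fun ν : K ↦ s.eigenspace ν :=
    DirectSum.isInternal_submodule_of_iSupIndep_of_iSup_eq_top s.eigenspaces_iSupIndep hdiag
  let I := (ν : K) × Fin (finrank K (s.eigenspace ν))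
  let v : Module.Basis I K V := hint.collectedBasis fun μ ↦ Module.finBasis K (s.eigenspace μ)
  haveI : Fintype I := FiniteDimensional.fintypeBasisIndex v
  have hsv : ∀ i : I, s (v i) = i.1 • v i := fun i ↦
    Module.End.mem_eigenspace_iff.mp (hint.collectedBasis_mem _ i)
  rw [eq_top_iff, ← v.end.span_eq, Submodule.span_le]
  rintro _ ⟨⟨i, j⟩, rfl⟩
  refine Submodule.mem_iSup_of_mem (i.1 - j.1) ?_
  rw [Module.End.mem_eigenspace_iff, LinearMap.sub_apply, LinearMap.mulLeft_apply, LinearMap.mulRight_apply]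
  have h1 := v.lie_end_of_apply_eq_smul Sigma.fst s hsv i j
  rwa [Ring.lie_def] at h1

end AdDiagonalisable

/-! ### §2 The multi-homogeneous Jacobson–Morozov theorem in `𝔤𝔩(M)` -/

section Linear

variable {K : Type u} [Field K] [CharZero K] {V : Type v} [AddCommGroup V] [Module K V] [FiniteDimensional K V]
  {ι : Type*}

/-- **(5.2) FOR `𝔤 = 𝔤𝔩(M)`, MULTI-GRADED FORM.**  Let `s : ι → End(M)` be a commuting family of diagonalisable operators
of a finite-dimensional `M` (characteristic `0`), `c : ι → K`, and `N ≠ 0` a nilpotent endomorphism with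
`s_i N - N s_i = c_i N` for all `i` (`N ∈ 𝔤𝔩(M)^χ`, `χ(s_i) = c_i`).  Then there are `H, F ∈ End(M)` with `(N, H, F)` an
`𝔰𝔩₂`-triple — `H ≠ 0`, `HN - NH = 2N`, `HF - FH = -2F`, `NF - FN = H` — such that `s_i H = H s_i` (`H ∈ 𝔤𝔩(M)^0`) and
`s_i F - F s_i = -c_i F` (`F ∈ 𝔤𝔩(M)^{-χ}`) for all `i`.  Proof: `𝔤𝔩(M)` is graded by the characters of the `ad s_i`
(§1 + A1-145 `isInternal_iInf_adDegree`); some triple through `N` exists (the tree's `exists_sl2Triple_of_isNilpotent`);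
A1-145's graded refinement `exists_mem_isSl2Triple_of_isSl2Triple` (the printed proof of (5.2)) makes it homogeneous.
[cite: LooijengaLunts1997, §5 (5.2) Lemma p. 20 L108–L121, (5.3) p. 21 L17–L19] -/
theorem exists_sl2Triple_of_isNilpotent_of_forall_commutator_eq {s : ι → Module.End K V}
    (hcomm : ∀ i j, s i * s j = s j * s i) (hdiag : ∀ i, ⨆ μ : K, (s i).eigenspace μ = ⊤) (c : ι → K)
    {N : Module.End K V} (hN : IsNilpotent N) (hN0 : N ≠ 0) (hsN : ∀ i, s i * N - N * s i = c i • N) :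
    ∃ H F : Module.End K V, H ≠ 0 ∧ H * N - N * H = (2 : K) • N ∧ H * F - F * H = -((2 : K) • F) ∧
      N * F - F * N = H ∧ (∀ i, s i * H = H * s i) ∧ ∀ i, s i * F - F * s i = -(c i • F) := by
  classical
  letI : LieRing (Module.End K V) := LieRing.ofAssociativeRing
  letI : LieAlgebra K (Module.End K V) := LieAlgebra.ofAssociativeAlgebra
  -- `𝔤𝔩(M)` is graded by the characters of the commuting diagonalisable family `ad s_i`
  have hcomm' : ∀ i j, ⁅s i, s j⁆ = 0 := fun i j ↦ sub_eq_zero.2 (hcomm i j)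
  have hdiag' : ∀ i, ⨆ μ : K, adDegree K (s i) μ = ⊤ := by
    intro i
    have had : LieAlgebra.ad K (Module.End K V) (s i) = LinearMap.mulLeft K (s i) - LinearMap.mulRight K (s i) :=
      LinearMap.ext fun _ ↦ rfl
    simp only [adDegree, had]
    exact iSup_eigenspace_mulLeft_sub_mulRight_eq_top (hdiag i)
  letI : GradedLieAlgebra (fun χ : ι → K ↦ ⨅ i, adDegree K (s i) (χ i)) :=
    { toDecomposition := (isInternal_iInf_adDegree hcomm' hdiag').chooseDecomposition
      bracket_mem := @fun α β x y hx hy ↦ lie_mem_iInf_adDegree hx hy }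
  have hNmem : N ∈ (fun χ : ι → K ↦ ⨅ i, adDegree K (s i) (χ i)) c :=
    (Submodule.mem_iInf _).2 fun i ↦ mem_adDegree_iff.2 (hsN i)
  -- "Choose an 𝔰𝔩₂-triple (e, h', f') containing e" — Jacobson–Morozov for the nilpotent endomorphism `N`
  obtain ⟨H', F', hH'0, h1, h2, h3⟩ := exists_sl2Triple_of_isNilpotent hN hN0
  have t' : IsSl2Triple H' N F' :=
    { h_ne_zero := hH'0
      lie_e_f := h3
      lie_h_e_nsmul := by rw [← ofNat_smul_eq_nsmul K 2 N]; exact h1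
      lie_h_f_nsmul := by rw [← ofNat_smul_eq_nsmul K 2 F']; exact h2 }
  -- the graded refinement (printed proof of (5.2))
  obtain ⟨F, hF, t⟩ := exists_mem_isSl2Triple_of_isSl2Triple (fun χ : ι → K ↦ ⨅ i, adDegree K (s i) (χ i)) t' hNmem
  have hH : ⁅N, F⁆ ∈ (fun χ : ι → K ↦ ⨅ i, adDegree K (s i) (χ i)) 0 :=
    lie_mem_zero_of_mem_of_mem_neg (fun χ : ι → K ↦ ⨅ i, adDegree K (s i) (χ i)) hNmem hF
  refine ⟨⁅N, F⁆, F, t.h_ne_zero, ?_, ?_, rfl, fun i ↦ ?_, fun i ↦ ?_⟩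
  · have h4 := t.lie_h_e_smul K; exact h4
  · have h4 := t.lie_lie_smul_f K; exact h4
  · have h4 := mem_adDegree_iff.1 ((Submodule.mem_iInf _).1 hH i)
    rw [Pi.zero_apply, zero_smul] at h4
    exact sub_eq_zero.1 h4
  · have h4 := mem_adDegree_iff.1 ((Submodule.mem_iInf _).1 hF i)
    rw [Pi.neg_apply, neg_smul] at h4
    exact h4

/-- **(5.2)–(5.3) FOR `𝔤 = 𝔤𝔩(M)` AND ONE GRADING OPERATOR (`𝔰 = Kh`).**  Let `s ∈ End(M)` be diagonalisable
(`M = ⊕_μ E_μ(s)`), `N ≠ 0` nilpotent with `sN - Ns = cN` (`N` homogeneous of degree `c`).  Then there is an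
`𝔰𝔩₂`-triple `(N, H, F)` of `𝔤𝔩(M)` with `sH = Hs` (`H` of degree `0`, i.e. `H` preserves the grading) and
`sF - Fs = -cF` (`F` of degree `-c`) — "an `𝔰𝔩₂`-triple `(e_a, h_hor, f_a)` … with `f_a` of total degree `-2` and
`h_hor` of total degree `0`". [cite: LooijengaLunts1997, §5 (5.2) Lemma p. 20 L108–L121, (5.3) p. 21 L17–L19] -/
theorem exists_sl2Triple_of_isNilpotent_of_commutator_eq {s : Module.End K V} (hdiag : ⨆ μ : K, s.eigenspace μ = ⊤)
    {c : K} {N : Module.End K V} (hN : IsNilpotent N) (hN0 : N ≠ 0) (hsN : s * N - N * s = c • N) :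
    ∃ H F : Module.End K V, H ≠ 0 ∧ H * N - N * H = (2 : K) • N ∧ H * F - F * H = -((2 : K) • F) ∧
      N * F - F * N = H ∧ s * H = H * s ∧ s * F - F * s = -(c • F) := by
  obtain ⟨H, F, hH0, h1, h2, h3, h4, h5⟩ := exists_sl2Triple_of_isNilpotent_of_forall_commutator_eq
    (s := fun _ : Unit ↦ s) (fun _ _ ↦ rfl) (fun _ ↦ hdiag) (fun _ ↦ c) hN hN0 (fun _ ↦ hsN)
  exact ⟨H, F, hH0, h1, h2, h3, h4 (), h5 ()⟩

/-- **The `ℤ`-graded case in the vocabulary of A1-88** (`IsZGrading h`: `M = ⊕_{k ∈ ℤ} M_k`, `h = k` on `M_k`): a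
nilpotent `N ≠ 0` of degree `d` (`hN - Nh = dN`, i.e. `N M_k ⊆ M_{k+d}`) lies in an `𝔰𝔩₂`-triple `(N, H, F)` of `𝔤𝔩(M)`
with `H` of degree `0` (`hH = Hh`) and `F` of degree `-d` — for `d = 2` and `N = e_a` this is (5.3)'s
"`(e_a, h_hor, f_a)` … with `f_a` of total degree `-2` and `h_hor` of total degree `0`" (in `𝔤𝔩(M)`; that the triple
lies in `𝔤(𝔞, M)` is A1-145 §5). [cite: LooijengaLunts1997, §5 (5.3) p. 21 L17–L19, (5.2) p. 20 L108–L121] -/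
theorem IsZGrading.exists_sl2Triple_of_isNilpotent {h : Module.End K V} (hgr : IsZGrading h) {d : ℤ}
    {N : Module.End K V} (hN : IsNilpotent N) (hN0 : N ≠ 0) (hhN : h * N - N * h = (d : K) • N) :
    ∃ H F : Module.End K V, H ≠ 0 ∧ H * N - N * H = (2 : K) • N ∧ H * F - F * H = -((2 : K) • F) ∧
      N * F - F * N = H ∧ h * H = H * h ∧ h * F - F * h = -((d : K) • F) := by
  refine exists_sl2Triple_of_isNilpotent_of_commutator_eq ?_ hN hN0 hhN
  rw [eq_top_iff, ← hgr]
  exact iSup_le fun k ↦ le_iSup (fun μ : K ↦ h.eigenspace μ) (k : K)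

/-! ### §3 The third member of a graded triple is automatically homogeneous -/

/-- **Automatic homogeneity of `F`** (Bourbaki VIII §11 no. 1 Lemma 1: the third member of an `𝔰𝔩₂`-triple is unique):
for a commuting family `s_i` of diagonalisable operators and an `𝔰𝔩₂`-triple `(N, H, F)` of `𝔤𝔩(M)` (`N ≠ 0`) with
`s_i H = H s_i` and `s_i N - N s_i = c_i N`, necessarily `s_i F - F s_i = -c_i F` (A1-145
`mem_iInf_adDegree_neg_of_isSl2Triple`). [cite: LooijengaLunts1997, §5 (5.2) proof, p. 20 L120–L121] [cite: Bourbaki2008LieGroups79, Ch. VIII §11 no. 1 Lemma 1] -/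
theorem forall_commutator_eq_neg_smul_of_sl2Triple {s : ι → Module.End K V} (hcomm : ∀ i j, s i * s j = s j * s i)
    (hdiag : ∀ i, ⨆ μ : K, (s i).eigenspace μ = ⊤) (c : ι → K) {H N F : Module.End K V} (hN0 : N ≠ 0)
    (h1 : H * N - N * H = (2 : K) • N) (h2 : H * F - F * H = -((2 : K) • F)) (h3 : N * F - F * N = H)
    (hsH : ∀ i, s i * H = H * s i) (hsN : ∀ i, s i * N - N * s i = c i • N) (i : ι) :
    s i * F - F * s i = -(c i • F) := by
  classical
  letI : LieRing (Module.End K V) := LieRing.ofAssociativeRing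
  letI : LieAlgebra K (Module.End K V) := LieAlgebra.ofAssociativeAlgebra
  have hcomm' : ∀ i j, ⁅s i, s j⁆ = 0 := fun i j ↦ sub_eq_zero.2 (hcomm i j)
  have hdiag' : ∀ i, ⨆ μ : K, adDegree K (s i) μ = ⊤ := by
    intro i
    have had : LieAlgebra.ad K (Module.End K V) (s i) = LinearMap.mulLeft K (s i) - LinearMap.mulRight K (s i) :=
      LinearMap.ext fun _ ↦ rfl
    simp only [adDegree, had]
    exact iSup_eigenspace_mulLeft_sub_mulRight_eq_top (hdiag i)
  have hH0 : H ≠ 0 := by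
    intro hH
    rw [hH, zero_mul, mul_zero, sub_zero] at h1
    exact hN0 ((smul_eq_zero.1 h1.symm).resolve_left two_ne_zero)
  have t : IsSl2Triple H N F :=
    { h_ne_zero := hH0
      lie_e_f := h3
      lie_h_e_nsmul := by rw [← ofNat_smul_eq_nsmul K 2 N]; exact h1
      lie_h_f_nsmul := by rw [← ofNat_smul_eq_nsmul K 2 F]; exact h2 }
  have hNmem : N ∈ ⨅ i, adDegree K (s i) (c i) := (Submodule.mem_iInf _).2 fun i ↦ mem_adDegree_iff.2 (hsN i)
  have hHmem : H ∈ ⨅ i, adDegree K (s i) 0 :=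
    (Submodule.mem_iInf _).2 fun i ↦ mem_adDegree_iff.2 (by rw [zero_smul]; exact sub_eq_zero.2 (hsH i))
  have h4 := mem_adDegree_iff.1
    ((Submodule.mem_iInf _).1 (mem_iInf_adDegree_neg_of_isSl2Triple hcomm' hdiag' c t hNmem hHmem) i)
  rw [neg_smul] at h4
  exact h4

/-- One diagonalisable operator: an `𝔰𝔩₂`-triple `(N, H, F)` of `𝔤𝔩(M)` with `sH = Hs`, `sN - Ns = cN` has
`sF - Fs = -cF`. [cite: LooijengaLunts1997, §5 (5.2) proof, p. 20 L120–L121] -/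
theorem commutator_eq_neg_smul_of_sl2Triple {s : Module.End K V} (hdiag : ⨆ μ : K, s.eigenspace μ = ⊤) {c : K}
    {H N F : Module.End K V} (hN0 : N ≠ 0) (h1 : H * N - N * H = (2 : K) • N) (h2 : H * F - F * H = -((2 : K) • F))
    (h3 : N * F - F * N = H) (hsH : s * H = H * s) (hsN : s * N - N * s = c • N) : s * F - F * s = -(c • F) :=
  forall_commutator_eq_neg_smul_of_sl2Triple (s := fun _ : Unit ↦ s) (fun _ _ ↦ rfl) (fun _ ↦ hdiag) (fun _ ↦ c)
    hN0 h1 h2 h3 (fun _ ↦ hsH) (fun _ ↦ hsN) ()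

end Linear

end Literature.Algebra.Lie
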